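import Literature.NumberTheory.EllipticCurves.SelmerTorsionOperatorLocalKernel
import HarnessLib

/-!
# Odd-norm elements of `ℤ[ω]` act invertibly on an `ω`-stable subgroup: `a•t + b•ω t ∈ T ↔ t ∈ T`

Topic `NumberTheory/EllipticCurves`; namespace `Literature.NumberTheory.EllipticCurves` (pure algebra in
the sub-namespace `EisensteinModule`). Theorems only: **no definition and no named fact is introduced**
(D-0026). Sequel of `SelmerTorsionOperatorLocalKernel` (#35: the case `a = 0, b = 1`, i.e. `ω` itself)
and of `JZeroTwoPowerTorsionKummer` (`CMTorsionLine.exists_mul_odd_zsmul_eq`: odd INTEGERS); here the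
general element `α = a + bω` of the Eisenstein order `𝒪 = ℤ[ω]`, `ω² + ω + 1 = 0`.

SETTING. An abelian group `V` with an additive endomorphism `w` satisfying `w (w x) + w x + x = 0` is a
`ℤ[ω]`-module (`ω ↦ w`); `α = a + bω` acts by `x ↦ a • x + b • w x`. Its conjugate is
`ᾱ = a + bω² = (a − b) − bω` and `ᾱ α = N(α) = a² − ab + b²` (`conj_apply_smul`: the operator identity
`(a − b) • (α x) − b • w (α x) = N(α) • x`). Hence on an element `t` killed by an integer `m` COPRIME to
`N(α)` (`u N(α) + v m = 1`), `α` is invertible: `t = u • ᾱ(α t)`. Consequences, for a `w`-STABLE subgroup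
`T ≤ V`: `α t ∈ T ↔ t ∈ T` (`smul_mem_iff`), the same for all multiples `c • t` (`zsmul_smul_mem_iff`),
and the `𝒪`-line is unchanged: `𝒪·(α t) = 𝒪·t` (`closure_pair_smul_eq`; the `𝒪`-line of `y` is
`AddSubgroup.closure {y, w y}`, `w`-stable by `w_mem_closure_pair`). At `m = 2^k` the coprimality is
«`N(α)` odd» `↔ ¬(a, b both even)` (`odd_norm_iff`, `isCoprime_of_odd_of_dvd_two_pow`): exactly the units
of `𝒪/2^k` (`2` is inert in `𝒪`).

USE (cell `bsd-cm`, crux stmt-BirchSwinnertonDyer-19804, RESIDUE c v3 (T-L1), planner D732/D734): the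
BOTTOM LINK of the class-term assembler compares `δ(Y) = ε • δ(Y₁)` for a 2-adic unit `ε ∈ (𝒪/4^κ)^×`
(NOT a global unit) inside the local kernels `T_B(λ) = torsionLocalKer`, which are `w`-stable for the CM
operator `w = H¹([ω]) = resH1Hom id fn hfn` (#35); §2 records the two local-kernel instances
(`…_mem_torsionLocalKer_iff`, `…_mem_selmerLocalKer_iff`) and the admissible-set instance
(`closure_pair_smul_eq`: the `𝒪`-line of `ε • y` is the `𝒪`-line of `y`).

## References

* [McCallumLMS1991] W. G. McCallum, *Kolyvagin's work on Shafarevich–Tate groups*, LMS LN 153 (1991),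
  §5 (the descent runs over `𝒪/p^M`; units of `𝒪/p^M` rescale classes freely).
* [GrossLMS1991] B. H. Gross, *Kolyvagin's work on modular elliptic curves*, LMS LN 153 (1991), §5 (5.1)
  (the `𝒪`-module structure on Selmer/`H¹` in the CM-by-`K` situation).
* [IrelandRosen1990] K. Ireland, M. Rosen, *A Classical Introduction to Modern Number Theory*, 2nd ed.,
  GTM 84 (held text `book:ireland1990-classical-introduction-modern-number-theory`, chunk p0105 L17 –
  p0106 L26): Ch. 9 §1 p. 109 (`Nα = αᾱ = a² − ab + b²`), Prop. 9.1.1 (units of `ℤ[ω]`), Prop. 9.1.4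
  (a rational prime `q ≡ 2 (3)` — e.g. `2` — is prime in `ℤ[ω]`); Ch. 1 §1 Lemma 4 (gcd in `ℤ`).
-/

noncomputable section

open scoped Classical

universe u

namespace Literature.NumberTheory.EllipticCurves

/-! ## §1 Pure algebra: `ℤ[ω]` acting through `w`, `w² + w + 1 = 0` -/

namespace EisensteinModule

variable {V : Type*} [AddCommGroup V] (w : V →+ V) (hw : ∀ x, w (w x) + w x + x = 0)

include hw in
/-- `w (w x) = −w x − x` (the relation `ω² = −ω − 1`). [cite: IrelandRosen1990, Ch. 9 §1 (the ring ℤ[ω], ω² + ω + 1 = 0)] -/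
theorem w_w_eq (x : V) : w (w x) = -w x - x := by
  have h := hw x
  rw [add_assoc, add_eq_zero_iff_eq_neg, neg_add'] at h
  exact h

include hw in
/-- **`ᾱ α = N(α)` as operators**: for `α = a + bω` acting by `x ↦ a • x + b • w x` and its conjugate
`ᾱ = (a − b) − bω`, `ᾱ (α x) = (a² − ab + b²) • x`. [cite: IrelandRosen1990, Ch. 9 §1 p. 109 (Nα = αᾱ = a² − ab + b²)] -/
theorem conj_apply_smul (a b : ℤ) (x : V) :
    (a - b) • (a • x + b • w x) - b • w (a • x + b • w x) = (a ^ 2 - a * b + b ^ 2) • x := by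
  rw [map_add, map_zsmul, map_zsmul, w_w_eq w hw]
  module

include hw in
/-- The `𝒪`-line `𝒪·y = closure {y, w y}` is `w`-stable. [cite: GrossLMS1991, §5 (5.1)] -/
theorem w_mem_closure_pair (y : V) {x : V} (hx : x ∈ AddSubgroup.closure ({y, w y} : Set V)) :
    w x ∈ AddSubgroup.closure ({y, w y} : Set V) := by
  induction hx using AddSubgroup.closure_induction with
  | mem x hx =>
    rcases hx with rfl | rfl
    · exact AddSubgroup.subset_closure (Set.mem_insert_of_mem _ rfl)
    · rw [w_w_eq w hw]
      exact sub_mem (neg_mem (AddSubgroup.subset_closure (Set.mem_insert_of_mem _ rfl)))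
        (AddSubgroup.subset_closure (Set.mem_insert _ _))
  | zero => rw [map_zero]; exact zero_mem _
  | add x y _ _ hx hy => rw [map_add]; exact add_mem hx hy
  | neg x _ hx => rw [map_neg]; exact neg_mem hx

include hw in
/-- **Odd-norm elements of `𝒪` act invertibly on a `w`-stable subgroup.** Let `T ≤ V` be `w`-stable,
`t ∈ V` with `m • t = 0`, and `α = a + bω` with `N(α) = a² − ab + b²` coprime to `m`. Then
`α t = a • t + b • w t ∈ T ↔ t ∈ T`: if `u N(α) + v m = 1` then `t = u • ᾱ(α t) + v • (m • t) = u • ᾱ(α t)`.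
[cite: McCallumLMS1991, §5 (classes over 𝒪/p^M)] -/
theorem smul_mem_iff (T : AddSubgroup V) (hT : ∀ x ∈ T, w x ∈ T) {m : ℤ} {t : V} (hmt : m • t = 0)
    {a b : ℤ} (hab : IsCoprime (a ^ 2 - a * b + b ^ 2) m) :
    a • t + b • w t ∈ T ↔ t ∈ T := by
  refine ⟨fun hs ↦ ?_, fun ht ↦ add_mem (T.zsmul_mem ht a) (T.zsmul_mem (hT t ht) b)⟩
  have hN : (a ^ 2 - a * b + b ^ 2) • t ∈ T := by
    rw [← conj_apply_smul w hw a b t]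
    exact sub_mem (T.zsmul_mem hs _) (T.zsmul_mem (hT _ hs) _)
  obtain ⟨u, v, huv⟩ := hab
  have key : t = u • ((a ^ 2 - a * b + b ^ 2) • t) + v • (m • t) := by
    rw [smul_smul, smul_smul, ← add_smul, huv, one_smul]
  rw [key, hmt, smul_zero, add_zero]
  exact T.zsmul_mem hN u

include hw in
/-- The same for all multiples: `c • (α t) ∈ T ↔ c • t ∈ T` (`α (c • t) = c • (α t)`). This carries
order conditions «`2^j • x ∉ T`» across a rescaling by a unit of `𝒪/2^k`.
[cite: McCallumLMS1991, §5, proof of Thm. 5.4] -/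
theorem zsmul_smul_mem_iff (T : AddSubgroup V) (hT : ∀ x ∈ T, w x ∈ T) {m : ℤ} {t : V}
    (hmt : m • t = 0) {a b : ℤ} (hab : IsCoprime (a ^ 2 - a * b + b ^ 2) m) (c : ℤ) :
    c • (a • t + b • w t) ∈ T ↔ c • t ∈ T := by
  have hct : m • (c • t) = 0 := by rw [smul_comm, hmt, smul_zero]
  rw [← smul_mem_iff w hw T hT hct hab, map_zsmul, zsmul_add, smul_comm c a, smul_comm c b]

include hw in
/-- **The `𝒪`-line is unchanged by an odd-norm rescaling**: `closure {α t, w (α t)} = closure {t, w t}`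
for `m • t = 0` and `N(α)` coprime to `m`. [cite: GrossLMS1991, §5 (5.1)] -/
theorem closure_pair_smul_eq {m : ℤ} {t : V} (hmt : m • t = 0) {a b : ℤ}
    (hab : IsCoprime (a ^ 2 - a * b + b ^ 2) m) :
    AddSubgroup.closure ({a • t + b • w t, w (a • t + b • w t)} : Set V) =
      AddSubgroup.closure ({t, w t} : Set V) := by
  have h1 : t ∈ AddSubgroup.closure ({t, w t} : Set V) := AddSubgroup.subset_closure (by simp)
  have h2 : w t ∈ AddSubgroup.closure ({t, w t} : Set V) := AddSubgroup.subset_closure (by simp)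
  have hs : a • t + b • w t ∈ AddSubgroup.closure ({t, w t} : Set V) :=
    add_mem (AddSubgroup.zsmul_mem _ h1 a) (AddSubgroup.zsmul_mem _ h2 b)
  have ht : t ∈ AddSubgroup.closure ({a • t + b • w t, w (a • t + b • w t)} : Set V) :=
    (smul_mem_iff w hw _ (fun _ hx ↦ w_mem_closure_pair w hw _ hx) hmt hab).mp
      (AddSubgroup.subset_closure (by simp))
  refine le_antisymm ((AddSubgroup.closure_le _).mpr ?_) ((AddSubgroup.closure_le _).mpr ?_)
  · rintro x (rfl | rfl)
    · exact hs
    · exact w_mem_closure_pair w hw _ hs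
  · rintro x (rfl | rfl)
    · exact ht
    · exact w_mem_closure_pair w hw _ ht

/-- `N(a + bω) = a² − ab + b²` is odd unless `a` and `b` are both even: the units of `𝒪/2^k` are the
classes of odd norm (`2` is prime in `ℤ[ω]`, residue field `𝔽₄`). [cite: IrelandRosen1990, Ch. 9 §1, Prop. 9.1.1 (units ⟺ N = 1) and Prop. 9.1.4 (q ≡ 2 (3) is prime in ℤ[ω])] -/
theorem odd_norm_iff (a b : ℤ) : Odd (a ^ 2 - a * b + b ^ 2) ↔ Odd a ∨ Odd b := by
  rw [← Int.not_even_iff_odd, ← Int.not_even_iff_odd, ← Int.not_even_iff_odd]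
  simp only [Int.even_sub, Int.even_add, Int.even_mul, Int.even_pow, ne_eq, OfNat.ofNat_ne_zero,
    not_false_eq_true, and_true]
  tauto

/-- An odd integer is coprime to every divisor of a power of `2` (Bezout: `1·(2r+1) − r·2 = 1`).
[cite: IrelandRosen1990, Ch. 1 §1, Lemma 4 and the Definition following it ((a, b) = 1)] -/
theorem isCoprime_of_odd_of_dvd_two_pow {N m : ℤ} (hN : Odd N) {k : ℕ} (hm : m ∣ 2 ^ k) :
    IsCoprime N m := by
  obtain ⟨r, rfl⟩ := hN
  have h2 : IsCoprime (2 * r + 1) 2 := ⟨1, -r, by ring⟩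
  exact h2.pow_right.of_isCoprime_of_dvd_right hm

end EisensteinModule

/-! ## §2 The instances on `H¹(K, E[n])`: local kernels and the `𝒪`-line of a class -/

section TorsionLocalKer

open _root_.WeierstrassCurve

variable {K : Type u} [Field K] {W : WeierstrassCurve K} (n : ℤ)
variable (E : Type u) [Field E] [Algebra K E]

/-- **`a • t + b • w t ∈ ker loc_E ↔ t ∈ ker loc_E` on `H¹(K, E[n])`** for the operator `w = H¹(fn)` of
an equivariant `fn = f|E[n]` with local points maps (every `K`-isogeny) satisfying `w² + w + 1 = 0`,
the local kernel `ker (H¹(K, E[n]) → H¹(E, E(K̄_E)[n]))` (`torsionLocalKer`, `w`-stable by #35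
`resH1Hom_id_mem_torsionLocalKer_of_hasLocalPointsMaps`), `m • t = 0` and `N(a + bω)` coprime to `m`.
[cite: McCallumLMS1991, §5, proof of Thm. 5.4] [cite: MilneADT2006, Ch. I §6 p. 75] -/
theorem zsmul_add_zsmul_resH1Hom_id_mem_torsionLocalKer_iff (fn : geomTorsion W n →+ geomTorsion W n)
    (hfn : ∀ (σ : Field.absoluteGaloisGroup K) (P : geomTorsion W n),
      fn (ContinuousMonoidHom.id _ σ • P) = σ • fn P)
    (f : W.geomPoints →+ W.geomPoints)
    (hcoe : ∀ P : geomTorsion W n, ((fn P : geomTorsion W n) : W.geomPoints) = f P)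
    (hloc : HasLocalPointsMaps W W f)
    (hrel : ∀ c, resH1Hom (ContinuousMonoidHom.id _) fn hfn (resH1Hom (ContinuousMonoidHom.id _) fn hfn c) +
      resH1Hom (ContinuousMonoidHom.id _) fn hfn c + c = 0)
    {m : ℤ} {t : galH1Torsion W n} (hmt : m • t = 0) {a b : ℤ}
    (hab : IsCoprime (a ^ 2 - a * b + b ^ 2) m) (c : ℤ) :
    c • (a • t + b • resH1Hom (ContinuousMonoidHom.id _) fn hfn t) ∈ W.torsionLocalKer E n ↔
      c • t ∈ W.torsionLocalKer E n :=
  EisensteinModule.zsmul_smul_mem_iff (resH1Hom (ContinuousMonoidHom.id _) fn hfn) hrel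
    (W.torsionLocalKer E n)
    (fun _ hx ↦ resH1Hom_id_mem_torsionLocalKer_of_hasLocalPointsMaps n E fn hfn f hcoe hloc hx) hmt hab c

/-- The same for the Selmer local condition `ker (H¹(K, E[n]) → H¹(E, E(K̄_E)))` (`selmerLocalKer`,
`w`-stable by `resH1Hom_id_mem_selmerLocalKer`). [cite: MilneADT2006, Ch. I §6 p. 75] -/
theorem zsmul_add_zsmul_resH1Hom_id_mem_selmerLocalKer_iff (fn : geomTorsion W n →+ geomTorsion W n)
    (hfn : ∀ (σ : Field.absoluteGaloisGroup K) (P : geomTorsion W n),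
      fn (ContinuousMonoidHom.id _ σ • P) = σ • fn P)
    (f : W.geomPoints →+ W.geomPoints)
    (hcoe : ∀ P : geomTorsion W n, ((fn P : geomTorsion W n) : W.geomPoints) = f P)
    (hloc : HasLocalPointsMaps W W f)
    (hrel : ∀ c, resH1Hom (ContinuousMonoidHom.id _) fn hfn (resH1Hom (ContinuousMonoidHom.id _) fn hfn c) +
      resH1Hom (ContinuousMonoidHom.id _) fn hfn c + c = 0)
    {m : ℤ} {t : galH1Torsion W n} (hmt : m • t = 0) {a b : ℤ}
    (hab : IsCoprime (a ^ 2 - a * b + b ^ 2) m) (c : ℤ) :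
    c • (a • t + b • resH1Hom (ContinuousMonoidHom.id _) fn hfn t) ∈ selmerLocalKer W E n ↔
      c • t ∈ selmerLocalKer W E n := by
  obtain ⟨fE, hfE, hcomp⟩ := hloc E
  exact EisensteinModule.zsmul_smul_mem_iff (resH1Hom (ContinuousMonoidHom.id _) fn hfn) hrel
    (selmerLocalKer W E n)
    (fun _ hx ↦ resH1Hom_id_mem_selmerLocalKer n E fn hfn f hcoe fE hfE hcomp hx) hmt hab c

end TorsionLocalKer

end Literature.NumberTheory.EllipticCurves

end
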